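import Summits.KontsevichZagierPeriods.KontsevichZagierPeriods.Theses.AbelContraction
import Literature.NumberTheory.Transcendental.KZSemiCanonicalReductionProofs

/-!
# KontsevichZagierPeriods / AbelContraction — crux `RealArcKernel` (stmt-KontsevichZagierPeriods-12472),
# line `dimtwo_redirect`, sub-stub `stub_mergeSolids` of `stub_kzDimTwo` (= item stmt-4280, whose
# registered line `bounded_solids` has exactly this stub, with `IsBoundedVolume` unfolded)

Two bounded volume representations of dimension `3` (bounded `ℚ`-semialgebraic domain, integrand `1`)
merge into one: `[u] − [s] − [t] ∈ KZ.relations` (translate `t` past a bounding box of `s`, rule (2);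
disjoint union, rule (1a)) — the tree's `KZ.exists_merge₂` in dimension `2 + 1`.

Source: M. Kontsevich, D. Zagier, *Periods* (2001), §1.2 rules (1)–(2); J. Viu-Sos (2021), Cor. 2.3.
-/

noncomputable section

open Literature.NumberTheory.Transcendental

namespace Summit.KontsevichZagierPeriods.AbelContraction.RealArcKernelStubMergeSolids

/-- **Merging bounded solids** (sub-stub `stub_mergeSolids` of line `dimtwo_redirect` / line
`bounded_solids` of stmt-4280): two bounded volume representations of dimension `3` merge into one
bounded volume representation `u` with `[u] − [s] − [t] ∈ KZ.relations`.
[cite: KontsevichZagier2001, §1.2 rules (1)–(2)] -/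
theorem stub_mergeSolids : ∀ (s t : KZ.IntegralRep 3), (Bornology.IsBounded s.domain ∧ ∀ z ∈ s.domain, s.integrand z = 1) → (Bornology.IsBounded t.domain ∧ ∀ z ∈ t.domain, t.integrand z = 1) → ∃ u : KZ.IntegralRep 3, (Bornology.IsBounded u.domain ∧ ∀ z ∈ u.domain, u.integrand z = 1) ∧ KZ.of u - KZ.of s - KZ.of t ∈ KZ.relations := by
  intro s t hs ht
  obtain ⟨u, hub, hui, h⟩ := KZ.exists_merge₂ s t hs.1 ht.1 hs.2 ht.2
  refine ⟨u, ⟨hub, hui⟩, ?_⟩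
  have e : KZ.of u - KZ.of s - KZ.of t = -(KZ.of s + KZ.of t - KZ.of u) := by abel
  rw [e]
  exact KZ.relations.neg_mem h

end Summit.KontsevichZagierPeriods.AbelContraction.RealArcKernelStubMergeSolids

end
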